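import Summits.QuantumFields.YangMills.Theses.IsotropyFromPowerCounting
import Summits.QuantumFields.YangMills.Theorems.SoftKernelBoostCovariance.Negative.TieLoadBearing
import Summits.QuantumFields.YangMills.Theorems.MirrorModularBoostsSoftKernelBoostCovarianceStepZeroOfLattice

/-!
# `TemperedCurvatureMoments` (T, stmt-QuantumFields-17721) — negative side: the Wilson tie AT ORDER 4 is load-bearing

Refuter crux-attack on the item `IsotropyFromPowerCounting.TemperedCurvatureMoments` (T): for every compact simple
`G`, `r`, `sch`, `S₁` with the curvature package `W₁` (tie + OS package + translations + proper hypercubic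
invariance + both gaps), the eight planar frames and the planar cone, every degree `n ≥ 1` admits lattice
densities `D_k`, TEMPERED at injective multi-sites uniformly in `k ≥ k₀`, whose Riemann sums converge to `S₁ n` on
the off-diagonal real tensors.

Nothing here refutes T.  What is certified is WHICH hypothesis any proof must consume:

* `TemperedApproximants a L S₁ n` — the conclusion of T in degree `n` along spacing/box data `(a, L)` (verbatim);
  `temperedCurvatureMoments_iff` — T unbundled (definitional).
* `not_temperedApproximants_junk` — the junk family of `NPointIsotropy.Negative` (E0, E0h, E0', E2 in all sixteen
  frames, E3, E4, translations, proper hypercubic invariance, mass gap, `𝔖₂|⁰𝒮 = 0`, planar cone) admits NO tempered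
  tied approximants along ANY `a_k → 0⁺`, `a_k L_k → ∞`: the landed model-blind glue `stub_stepZeroOfLattice`
  (p137944) would make it `NPointRegular`, against the landed `not_nPointRegular_junk` (its `𝔖₄|⁰𝒮` charges the
  Lebesgue-null planar-degenerate set).
* `TemperedCurvatureMomentsWithoutTieAt4` — T with the Wilson-convergence clause of `W₁` required at every order
  `n ≠ 4` ONLY; the OS package, translations, hypercubic invariance, the continuum gap, the uniform lattice gap
  `HasLatticeMassGap`, the eight frames and the cone all kept verbatim.  `not_TemperedCurvatureMomentsWithoutTieAt4`
  REFUTES it: `G = SU(2)`, fundamental representation, the zero scheme (`β ≡ 0`, `c ≡ 0`), `S₁ = junk`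
  (`junk_hypotheses_softWithoutTieAt4`).  Chain `ModelBlind → WithoutTie → WithoutTieAt4 → T`
  (`temperedCurvatureMoments_of_withoutTieAt4`), so the model-blind core and the tie-free form are false too.

MORAL for provers of T: no combination of the OS-side clauses (sixteen-frame RP, cone, gaps, `K`) yields tempered
densities in degree `4`; the temperedness of `𝔖₄|⁰𝒮` must be extracted from the lattice FOUR-point functions of
`tr F²` themselves — i.e. from a k-uniform bound on the true renormalised Wilson moment densities
`c_k⁴ · W_k` in the regime `sup_k |c_k| = ∞` (the landed `temperedCurvatureMoments_of_bddRenormalisation`,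
p140303, settles bounded `c_k`; `DegreeOne`/`DegreeTwo` settle `n ≤ 2`).
-/

noncomputable section

-- Mathlib's `SimplexCategory` instance `Fintype (Fin (x.len + 1))` matches `Fintype (Fin 4)` and makes concrete
-- `Fin 4` instance paths diverge between elaborations (tree-known workaround, cf. the imported support files).
attribute [-instance] SimplexCategory.instFintypeToTypeOrderHomFinHAddNatLenOfNat

namespace Summit.QuantumFields.YangMills.Theorems.TemperedCurvatureMoments.Negative

open scoped BigOperators SchwartzMap
open MeasureTheory Filter Topology
open Literature.MathematicalPhysics.QuantumLattice Literature.MathematicalPhysics.AQFT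
  Literature.MathematicalPhysics.QuantumFieldTheory
open Literature.Probability.LatticeModels (box Site)
open Summit.QuantumFields.YangMills.Theorems.NPointIsotropy.Negative
  (E4 NPointRegular junk junk_isNormalized not_nPointRegular_junk)
open Summit.QuantumFields.YangMills.Theorems.CurvatureBoostCovariance.Negative
  (OSPackage Translations Hypercubic EightFrameRP PlanarCone Tie Gaps W1)
open Summit.QuantumFields.YangMills.Theorems.SoftKernelBoostCovariance.Negative (junk_hypotheses_softWithoutTieAt4)
open Summit.QuantumFields.YangMills.Theorems.SoftKernelBoostCovariance.Sketch (stub_stepZeroOfLattice)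
open Summit.QuantumFields.YangMills.Theses.IsotropyFromPowerCounting (TemperedCurvatureMoments)

/-! ## §0 The conclusion of T, named; T unbundled -/

/-- **Tempered tied lattice approximants in degree `n`** along spacings `a` and box half-sides `L` (VERBATIM the
conclusion of T at `(sch.a, sch.L, S₁, n)`): densities `D_k` on `(ℤ⁴)ⁿ`, tempered at injective multi-sites of the
box for `k ≥ k₀`, whose Riemann sums converge to `S₁ n F` on every off-diagonal real tensor `F = ⊗ᵢ fᵢ`. -/
def TemperedApproximants (a : ℕ → ℝ) (L : ℕ → ℕ) (S₁ : SchwingerFamily E4) (n : ℕ) : Prop :=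
  ∃ (D : ℕ → (Fin n → Site 4) → ℝ) (C : ℝ) (N k₀ : ℕ), 0 < C ∧
    (∀ k : ℕ, k₀ ≤ k → ∀ x : Fin n → Site 4, (∀ i, x i ∈ box 4 (L k)) → Function.Injective x →
      |D k x| ≤ C * (1 + ‖fun i => a k • siteToE (x i)‖) ^ N *
        (1 + ∑ i, ∑ j ∈ Finset.univ.erase i, ‖a k • siteToE (x i) - a k • siteToE (x j)‖⁻¹) ^ N) ∧
    ∀ (f : Fin n → 𝓢(E4, ℝ)) (F : 𝓢((Fin n → E4), ℂ)),
      IsTensorOf F (fun i => ofRealTest (f i)) → IsOffDiagonal F →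
        Tendsto (fun k => (((a k ^ 4) ^ n *
          ∑ x ∈ Fintype.piFinset (fun _ : Fin n => box 4 (L k)),
            (∏ i, f i (a k • siteToE (x i))) * D k x : ℝ) : ℂ)) atTop (𝓝 (S₁ n F))

/-- **§0. T unbundled** (definitional): for every compact simple `G`,
`W1 r sch S₁ → EightFrameRP S₁ → PlanarCone S₁ → ∀ n > 0, TemperedApproximants sch.a sch.L S₁ n`. [folklore] -/
theorem temperedCurvatureMoments_iff :
    TemperedCurvatureMoments ↔
      ∀ (G : Type) [Group G] [TopologicalSpace G] [IsTopologicalGroup G] [CompactSpace G]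
        [MeasurableSpace G] [BorelSpace G], IsCompactSimpleLieGroup G →
        ∀ (r : LatticeRep G) (sch : SpeciesScheme (YMSpecies G)) (S₁ : SchwingerFamily E4),
          W1 r sch S₁ → EightFrameRP S₁ → PlanarCone S₁ →
            ∀ n : ℕ, 0 < n → TemperedApproximants sch.a sch.L S₁ n :=
  Iff.rfl

/-! ## §1 The junk family has no tempered tied approximants -/

/-- **§1. No tempered tied approximants for `junk`.**  Along ANY spacings `a_k → 0⁺` and half-sides with
`a_k L_k → ∞`, the junk family does not admit tempered tied lattice approximants in all positive degrees: by the
landed model-blind glue `stub_stepZeroOfLattice` it would be `NPointRegular`, which `not_nPointRegular_junk`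
refutes (degree `4`). [folklore] -/
theorem not_temperedApproximants_junk {a : ℕ → ℝ} {L : ℕ → ℕ} (ha : ∀ k, 0 < a k)
    (ha₀ : Tendsto a atTop (𝓝 0)) (haL : Tendsto (fun k => a k * L k) atTop atTop) :
    ¬ (∀ n : ℕ, 0 < n → TemperedApproximants a L junk n) := fun h =>
  not_nPointRegular_junk (stub_stepZeroOfLattice a L junk ha ha₀ haL junk_isNormalized h)

/-- In every degree `n ∉ {0, 4}` the junk family DOES have tempered tied approximants (`D ≡ 0`, as `𝔖ₙ = 0`):
the obstruction of §1 sits exactly in degree `4`. [folklore] -/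
theorem temperedApproximants_junk_of_ne_four (a : ℕ → ℝ) (L : ℕ → ℕ) {n : ℕ} (hn : n ≠ 0) (h4 : n ≠ 4) :
    TemperedApproximants a L junk n := by
  refine ⟨fun _ _ => 0, 1, 0, 0, one_pos, fun k _ x _ _ => by simp, fun f F _ _ => ?_⟩
  have hj : junk n F = 0 := by
    rw [Summit.QuantumFields.YangMills.Theorems.NPointIsotropy.Negative.junk_of_ne hn h4]; rfl
  rw [hj]
  refine tendsto_const_nhds.congr fun k => ?_
  simp

/-! ## §2 T without the tie at order 4 is false -/

/-- **T without the tie AT ORDER 4**: the Wilson-convergence clause of `W₁` is required for every `n ≠ 0` with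
`n ≠ 4`; every other clause of `W₁` (OS package, translations, proper hypercubic invariance, continuum gap AND the
uniform lattice gap), the eight-frame RP and the planar cone are kept verbatim, as is the conclusion. -/
def TemperedCurvatureMomentsWithoutTieAt4 : Prop :=
  ∀ (G : Type) [Group G] [TopologicalSpace G] [IsTopologicalGroup G] [CompactSpace G]
    [MeasurableSpace G] [BorelSpace G], IsCompactSimpleLieGroup G →
    ∀ (r : LatticeRep G) (sch : SpeciesScheme (YMSpecies G)) (S₁ : SchwingerFamily E4),
      ((∀ (n : ℕ), n ≠ 0 → n ≠ 4 → ∀ (f : Fin n → 𝓢(E4, ℝ)) (F : 𝓢((Fin n → E4), ℂ)),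
          IsTensorOf F (fun i => ofRealTest (f i)) → IsOffDiagonal F →
            Tendsto (fun k : ℕ => ((latticeSchwinger r.ρ sch (fun s => s.F) k n
              (fun _ => r.curvature) f : ℝ) : ℂ)) atTop (𝓝 (S₁ n F))) ∧
        OSPackage S₁ ∧ Translations S₁ ∧ Hypercubic S₁ ∧ Gaps r sch S₁) →
      EightFrameRP S₁ → PlanarCone S₁ → ∀ n : ℕ, 0 < n → TemperedApproximants sch.a sch.L S₁ n

/-- **T without the tie at all** (both gaps kept). -/
def TemperedCurvatureMomentsWithoutTie : Prop :=
  ∀ (G : Type) [Group G] [TopologicalSpace G] [IsTopologicalGroup G] [CompactSpace G]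
    [MeasurableSpace G] [BorelSpace G], IsCompactSimpleLieGroup G →
    ∀ (r : LatticeRep G) (sch : SpeciesScheme (YMSpecies G)) (S₁ : SchwingerFamily E4),
      OSPackage S₁ → Translations S₁ → Hypercubic S₁ → Gaps r sch S₁ →
      EightFrameRP S₁ → PlanarCone S₁ → ∀ n : ℕ, 0 < n → TemperedApproximants sch.a sch.L S₁ n

/-- **The model-blind core of T**: every clause about `S₁` alone (OS package, translations, hypercubic
invariance, continuum gap, eight frames, cone), along arbitrary scaling data `a_k → 0⁺`, `a_k L_k → ∞`. -/
def TemperedCurvatureMomentsModelBlind : Prop :=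
  ∀ (S₁ : SchwingerFamily E4), OSPackage S₁ → Translations S₁ → Hypercubic S₁ →
    (∃ Δ : ℝ, 0 < Δ ∧ S₁.toLabelled.HasMassGap Δ) → EightFrameRP S₁ → PlanarCone S₁ →
    ∀ (a : ℕ → ℝ) (L : ℕ → ℕ), (∀ k, 0 < a k) → Tendsto a atTop (𝓝 0) →
      Tendsto (fun k => a k * L k) atTop atTop → ∀ n : ℕ, 0 < n → TemperedApproximants a L S₁ n

/-- `WithoutTieAt4 → T` (drop the order-4 instance of the tie). [folklore] -/
theorem temperedCurvatureMoments_of_withoutTieAt4 (h : TemperedCurvatureMomentsWithoutTieAt4) :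
    TemperedCurvatureMoments := by
  rw [temperedCurvatureMoments_iff]
  intro G _ _ _ _ _ _ hG r sch S₁ hW h8 hC
  exact h G hG r sch S₁ ⟨fun n hn _ => hW.1 n hn, hW.2⟩ h8 hC

/-- `WithoutTie → WithoutTieAt4`. [folklore] -/
theorem withoutTieAt4_of_withoutTie (h : TemperedCurvatureMomentsWithoutTie) :
    TemperedCurvatureMomentsWithoutTieAt4 :=
  fun G _ _ _ _ _ _ hG r sch S₁ hW h8 hC => h G hG r sch S₁ hW.2.1 hW.2.2.1 hW.2.2.2.1 hW.2.2.2.2 h8 hC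

/-- `ModelBlind → WithoutTie` (specialise the scaling data to the scheme's, forget the lattice gap). [folklore] -/
theorem withoutTie_of_modelBlind (h : TemperedCurvatureMomentsModelBlind) :
    TemperedCurvatureMomentsWithoutTie :=
  fun _ _ _ _ _ _ _ _ _ sch S₁ hOS htr hhyp hgap h8 hC =>
    h S₁ hOS htr hhyp (hgap.imp fun _ hΔ => ⟨hΔ.1, hΔ.2.1⟩) h8 hC sch.a sch.L sch.a_pos sch.tendsto_a
      sch.tendsto_L

/-- **Theorem (the tie at order 4 is load-bearing for T).**  `TemperedCurvatureMomentsWithoutTieAt4` is false: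
`G = SU(2)`, the fundamental representation, the zero scheme (`a_k = 1/(k+1)`, `L_k = (k+1)²`, `β = c = m ≡ 0`),
`S₁ = junk`; every hypothesis holds (`junk_hypotheses_softWithoutTieAt4`: the tie at all orders `≠ 4`, the OS
package, translations, hypercubic invariance, both gaps with `Δ = 1`, the eight frames, the cone) and the junk
family has no tempered tied approximants (§1).  Hence any proof of T must use the convergence of the lattice
FOUR-point functions of `tr F²` at order `4` itself, quantitatively. [folklore] -/
theorem not_TemperedCurvatureMomentsWithoutTieAt4 : ¬ TemperedCurvatureMomentsWithoutTieAt4 := by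
  intro h
  have hG : IsCompactSimpleLieGroup (Matrix.specialUnitaryGroup (Fin 2) ℂ) :=
    isCompactSimpleLieGroup_specialUnitaryGroup isSimpleCompactGroup_specialUnitaryGroup_holds le_rfl
  letI : MeasurableSpace (Matrix.specialUnitaryGroup (Fin 2) ℂ) := borel _
  haveI : BorelSpace (Matrix.specialUnitaryGroup (Fin 2) ℂ) := ⟨rfl⟩
  let r : LatticeRep (Matrix.specialUnitaryGroup (Fin 2) ℂ) :=
    ⟨2, fundamentalRep (Fin 2), continuous_fundamentalRep _, fundamentalRep_injective _,
      fundamentalRep_mem_unitaryGroup⟩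
  obtain ⟨hW, h8, hC, -⟩ := junk_hypotheses_softWithoutTieAt4 r
  exact not_temperedApproximants_junk (SpeciesScheme.zero (YMSpecies (Matrix.specialUnitaryGroup (Fin 2) ℂ))).a_pos
    (SpeciesScheme.zero _).tendsto_a (SpeciesScheme.zero _).tendsto_L
    (h (Matrix.specialUnitaryGroup (Fin 2) ℂ) hG r (SpeciesScheme.zero _) junk hW h8 hC)

/-- **Corollary (the whole tie is load-bearing; the lattice gap does not rescue the tie-free form).** [folklore] -/
theorem not_TemperedCurvatureMomentsWithoutTie : ¬ TemperedCurvatureMomentsWithoutTie :=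
  fun h => not_TemperedCurvatureMomentsWithoutTieAt4 (withoutTieAt4_of_withoutTie h)

/-- **Corollary (the model-blind core of T is false).**  Sixteen-frame RP, the cone, the gaps and `K = 0` do not
make `𝔖₄|⁰𝒮` order-zero: the junk family. [folklore] -/
theorem not_TemperedCurvatureMomentsModelBlind : ¬ TemperedCurvatureMomentsModelBlind :=
  fun h => not_TemperedCurvatureMomentsWithoutTie (withoutTie_of_modelBlind h)

end Summit.QuantumFields.YangMills.Theorems.TemperedCurvatureMoments.Negative

end
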